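import Summits.QuantumFields.YangMills.Theorems.VirialFluxGapFixCoord
import Summits.QuantumFields.YangMills.Theorems.VirialFluxGapFixSliceGrowth
import Summits.QuantumFields.YangMills.Theorems.VirialFluxGapFixTubeCovering
import Summits.QuantumFields.YangMills.Theorems.VirialFluxGapFixFloor
import Literature.MathematicalPhysics.QuantumFieldTheory.Balaban1983to89.T4ExpWindowSmallField
import HarnessLib

/-!
# Off the tubes of the anchor slice the twisted deficit has a polynomial floor — `hfloor` of ✓`sharpTwistedLaplace_of_fixTubes` in tube letters
# (item (R5) of the DIRECT Laplace road to ⟨stmt-QuantumFields-24204⟩ `VirialFluxGap.SharpTwistedLaplace`)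

Helper module (free-hands work of width seat ym-line-sfw-p2-w2 g50, cell ym-idea-1; `--supports 24204`).  ✓`exists_conj_anchorSlice_of_ringDistSq_lt`
(this seat) says: a point `x ∈ X_fix` at squared chordal ring distance `< ρ ≤ 1/1600` from a zero is, after a constant gauge transformation `k`, a point
of the ANCHOR SLICE of some base ring `Q_s` with all coordinates within `81√ρ`.  Here this is converted into MEMBERSHIP IN THE TUBE
`Θ_s(SU(2) × B̄_V(0,R_V))`, `Θ_s(k,v) = k·fixSlice_s(fixCoord v)` (w3 g57's ✓`FixSplit.fixSlice`, ✓`fixCoord`; tube as in ✓`FixSplit.fix_hT`):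
* §1 `exists_fixCoord_eq` — the block-reading coordinate map is ONTO;
* §2 `fixSlice_logCoords_eq` — a point of `X_fix` whose anchors are `seamSlice t`, `linkSlice b₁ b₂` IS the slice point with rest coordinates
  `logVec(su2Quat(u·q⁻¹))` (✓`T4ExpWindowSmallField.expPoint_logVec`), with `‖logVec(su2Quat(u q⁻¹))‖ ≤ (π/2)‖su2Quat u − su2Quat q‖`;
* §3 ★★ `exists_mem_fixTube_of_ringDistSq_lt` — if `x′` is a zero of `F_fix` with `D(ιx, ιx′) < ρ ≤ 1/1600` then `x ∈ Θ_s(SU(2) × B̄(0,R_V))` for some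
  sign class `s`, as soon as `R_V² ≥ 4·10⁵·L⁴·ρ`;
* §4 ★★ `ringDeficit_fix_floor_off_tubes` — hence (✓`QuantitativeLaplace.ringDeficit_fix_floor` + `csInf`) OFF the union of the `8` tubes
  `F_fix ≥ min((KL^q)⁻¹, ρ/(1010L⁶KL^q))` with `ρ = min(1/1600, R_V²/(4·10⁵L⁴))` — polynomial in `L` for polynomial `R_V`.
Everything here is PROVED; no definitions (namespace `Summit.QuantumFields.YangMills.Theorems.VirialFluxGap.AnchorSlice`).

HONEST FRAMING: bookkeeping; ⟨24204⟩, ⟨24319⟩, ⟨22884⟩ and every rung stay OPEN; the Yang–Mills mass gap (Clay) is NOT touched; no summit is proved by a line.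

## References
* G. E. Bredon, *Introduction to Compact Transformation Groups* (1972), Ch. II §§4–5. [Bredon1972]
-/

set_option autoImplicit false

noncomputable section

open scoped Quaternion RealInnerProductSpace BigOperators
open NormedSpace Metric Set WithLp
open Literature.MathematicalPhysics.QuantumFieldTheory hiding SU2 su2Quat_mul
open Literature.MathematicalPhysics.QuantumLattice
open Literature.MathematicalPhysics.QuantumFieldTheory.Balaban1983to89.T4HaarSU2Translate (su2Quat_mul)
open Literature.MathematicalPhysics.QuantumFieldTheory.Balaban1983to89.T4WilsonLinkAffine (su2Quat_inv)
open Literature.MathematicalPhysics.QuantumFieldTheory.Balaban1983to89.T4HaarSU2ExpChart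
open Literature.MathematicalPhysics.QuantumFieldTheory.Balaban1983to89.T4ExpWindowSmallField (logVec norm_logVec expPoint_logVec)
open Summit.QuantumFields.YangMills.Theorems.FemtoTransferGap
open Summit.QuantumFields.YangMills.Theorems.FemtoTransferGap.TT
open Summit.QuantumFields.YangMills.Theorems.FemtoTransferGap.TwoLattice
open Summit.QuantumFields.YangMills.Theorems.FemtoTransferGap.TwoLattice.Flat
open Summit.QuantumFields.YangMills.Theorems.ToronValleyVolume.Lojasiewicz
open Summit.QuantumFields.YangMills.Theorems.TwistEaterVolume.Quadratic
open Summit.QuantumFields.YangMills.Theorems.VirialFluxGap.RingDeficit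
open Summit.QuantumFields.YangMills.Theorems.VirialFluxGap.FixSplit
open Summit.QuantumFields.YangMills.Theorems.QuantitativeLaplace (not_treeEdge_wrap su2Quat_centreElem)

namespace Summit.QuantumFields.YangMills.Theorems.VirialFluxGap.AnchorSlice

variable {L : ℕ} [NeZero L]

/-! ## §1 The coordinate map is onto -/

/-- ★ `fixCoord` is onto: every slice coordinate tuple is read from some Euclidean vector. [folklore] -/
theorem exists_fixCoord_eq {e₀ : OffIdx L} {y₀ : Site 3 L} (y : EuclideanSpace ℝ (Fin 3) × RestParam L e₀ y₀) :
    ∃ v : EuclideanSpace ℝ (Fin (fixDim L e₀ y₀)), fixCoord v = y := by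
  let g : FixIdx L e₀ y₀ → ℝ := fun n => match n with
    | Sum.inl m => y.1 m
    | Sum.inr (Sum.inl im) => y.2.1 im.1 im.2
    | Sum.inr (Sum.inr (Sum.inl jem)) => y.2.2.1 jem.1.1 jem.1.2 jem.2
    | Sum.inr (Sum.inr (Sum.inr sm)) => y.2.2.2 sm.1 sm.2
  refine ⟨toLp 2 (fun n => g ((fixIdxEquiv L e₀ y₀).symm n)), ?_⟩
  unfold fixCoord
  refine Prod.ext ?_ (Prod.ext ?_ (Prod.ext ?_ ?_))
  · ext m; simp [g]
  · funext i; ext m; simp [g]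
  · funext j e; ext m; simp [g]
  · funext x; ext m; simp [g]

/-! ## §2 Reconstruction of the slice point from a point with slice anchors -/

/-- The rest coordinate `logVec(su2Quat(u q⁻¹))` reproduces `u`: `expPoint(logVec(su2Quat(u q⁻¹)))·q = u`. [folklore] -/
theorem expPoint_logVec_mul (u q : SU2) : expPoint (logVec (su2Quat (u * q⁻¹))) * q = u := by
  rw [expPoint_logVec, inv_mul_cancel_right]

/-- … and is small when `u` is close to `q`: `‖logVec(su2Quat(u q⁻¹))‖ ≤ (π/2)·‖su2Quat u − su2Quat q‖`. [folklore] -/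
theorem norm_logVec_mul_inv_le (u q : SU2) : ‖logVec (su2Quat (u * q⁻¹))‖ ≤ Real.pi / 2 * ‖su2Quat u - su2Quat q‖ := by
  rw [norm_logVec]
  have h1 := arccos_re_le_of_unit (norm_su2Quat (u * q⁻¹))
  have h2 : ‖su2Quat (u * q⁻¹) - 1‖ = ‖su2Quat u - su2Quat q‖ := by
    have e : su2Quat (u * q⁻¹) - 1 = (su2Quat u - su2Quat q) * su2Quat q⁻¹ := by
      rw [su2Quat_mul, sub_mul, ← su2Quat_mul q q⁻¹, mul_inv_cancel, FemtoTransferGap.su2Quat_one]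
    rw [e, norm_mul, norm_su2Quat, mul_one]
  rw [h2] at h1; exact h1

omit [NeZero L] in
/-- ★ **Reconstruction**: a point of `X_fix` whose anchors are `seamSlice t` and `linkSlice b₁ b₂` IS the slice point of the base `R` with
coordinates `((t, b₁, b₂), logVec(su2Quat(u_c · R_c⁻¹))_c)`. [cite: Bredon1972, Ch. II §4] -/
theorem fixSlice_logCoords_eq (ωC ωN ωX : EuclideanSpace ℝ (Fin 3)) (C₀ Ns : SU2) {e₀ : OffIdx L} {y₀ : Site 3 L} (R : FixRest L e₀ y₀)
    (x : (OffIdx L → SU2) × ((Fin (2 * L - 1) → GaugeConfig 3 L SU2) × (Site 3 L → SU2))) {t b₁ b₂ : ℝ}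
    (hseam : x.2.2 y₀ = seamSlice ωC C₀ t) (hlink : x.1 e₀ = linkSlice ωN ωX Ns b₁ b₂) :
    fixSlice ωC ωN ωX C₀ Ns R
        (toLp 2 ![t, b₁, b₂],
          ((fun i => logVec (su2Quat (x.1 i.1 * (R.1 i)⁻¹))),
            ((fun j e => logVec (su2Quat (x.2.1 j e * (R.2.1 j e)⁻¹))), fun s => logVec (su2Quat (x.2.2 s.1 * (R.2.2 s)⁻¹))))) = x := by
  apply (fixSplit L e₀ y₀).injective
  unfold fixSlice
  rw [MeasurableEquiv.apply_symm_apply]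
  show ((seamSlice ωC C₀ t, linkSlice ωN ωX Ns b₁ b₂), restChart R 1 _) = ((x.2.2 y₀, x.1 e₀), (fun i => x.1 i.1, (x.2.1, fun y => x.2.2 y.1)))
  refine Prod.ext (Prod.ext hseam.symm hlink.symm) (Prod.ext ?_ (Prod.ext ?_ ?_))
  · funext i
    show 1 * (expPoint (logVec (su2Quat (x.1 i.1 * (R.1 i)⁻¹))) * R.1 i) * 1⁻¹ = x.1 i.1
    rw [one_mul, inv_one, mul_one, expPoint_logVec_mul]
  · funext j e
    show 1 * (expPoint (logVec (su2Quat (x.2.1 j e * (R.2.1 j e)⁻¹))) * R.2.1 j e) * 1⁻¹ = x.2.1 j e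
    rw [one_mul, inv_one, mul_one, expPoint_logVec_mul]
  · funext s
    show 1 * (expPoint (logVec (su2Quat (x.2.2 s.1 * (R.2.2 s)⁻¹))) * R.2.2 s) * 1⁻¹ = x.2.2 s.1
    rw [one_mul, inv_one, mul_one, expPoint_logVec_mul]

/-! ## §3 Near a zero, the point lies in one of the tubes -/

/-- Jordan's inequality in the form `|t| ≤ (π/2)|sin t|` for `|t| < π/2`. [folklore] -/
theorem abs_le_pi_div_two_mul_abs_sin {t : ℝ} (ht : |t| < Real.pi / 2) : |t| ≤ Real.pi / 2 * |Real.sin t| := by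
  have key : ∀ u : ℝ, 0 ≤ u → u < Real.pi / 2 → u ≤ Real.pi / 2 * Real.sin u := fun u hu hu' => by
    have h := Real.mul_le_sin hu hu'.le
    have hπ := Real.pi_pos
    rw [div_mul_eq_mul_div, div_le_iff₀ hπ] at h
    nlinarith
  rcases le_or_gt 0 t with h0 | h0
  · rw [abs_of_nonneg h0] at ht ⊢
    have hs : 0 ≤ Real.sin t := Real.sin_nonneg_of_nonneg_of_le_pi h0 (by linarith [Real.pi_pos])
    rw [abs_of_nonneg hs]; exact key t h0 ht
  · rw [abs_of_neg h0] at ht ⊢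
    have h := key (-t) (by linarith) ht
    rw [Real.sin_neg] at h
    have hs : Real.sin t ≤ 0 := by
      have := Real.sin_nonneg_of_nonneg_of_le_pi (x := -t) (by linarith) (by linarith [Real.pi_pos]); rw [Real.sin_neg] at this; linarith
    rw [abs_of_nonpos hs]; exact h

/-- A sum of squares over a finite type is at most `card · M²` when every term has norm `≤ M`. [folklore] -/
theorem sum_sq_le_card_mul {α : Type*} [Fintype α] {f : α → ℝ} {M : ℝ} (h : ∀ a, |f a| ≤ M) :
    ∑ a, f a ^ 2 ≤ Fintype.card α * M ^ 2 := by
  calc ∑ a, f a ^ 2 ≤ ∑ _a : α, M ^ 2 := Finset.sum_le_sum fun a _ => by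
          have := h a; rw [abs_le] at this; nlinarith
    _ = Fintype.card α * M ^ 2 := by rw [Finset.sum_const, Finset.card_univ, nsmul_eq_mul]

/-- The Euclidean norm of the reconstructed slice coordinates is `O(L²√ρ)`: if the anchors' parameters satisfy `|t| < π/2`, `|sin t| ≤ √ρ`,
`b₁² + b₂² ≤ 225ρ` and every other coordinate of the point is within `81√ρ` of the base, then `‖v‖² ≤ 2·10⁵·L⁴·ρ`. [folklore] -/
theorem norm_sq_le_of_logCoords {e₀ : OffIdx L} (R : FixRest L e₀ 0)
    (xt : (OffIdx L → SU2) × ((Fin (2 * L - 1) → GaugeConfig 3 L SU2) × (Site 3 L → SU2))) {t b₁ b₂ ρ : ℝ} (hρ0 : 0 ≤ ρ)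
    (htπ : |t| < Real.pi / 2) (hsin : |Real.sin t| ≤ Real.sqrt ρ) (hb : b₁ ^ 2 + b₂ ^ 2 ≤ 225 * ρ)
    (hoff : ∀ i : {i : OffIdx L // ¬ i = e₀}, ‖su2Quat (xt.1 i.1) - su2Quat (R.1 i)‖ ≤ 81 * Real.sqrt ρ)
    (hslice : ∀ j e, ‖su2Quat (xt.2.1 j e) - su2Quat (R.2.1 j e)‖ ≤ 81 * Real.sqrt ρ)
    (hsite : ∀ y : {y : Site 3 L // ¬ y = 0}, ‖su2Quat (xt.2.2 y.1) - su2Quat (R.2.2 y)‖ ≤ 81 * Real.sqrt ρ)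
    (v : EuclideanSpace ℝ (Fin (fixDim L e₀ 0)))
    (hv : fixCoord v = (toLp 2 ![t, b₁, b₂],
        ((fun i => logVec (su2Quat (xt.1 i.1 * (R.1 i)⁻¹))),
          ((fun j e => logVec (su2Quat (xt.2.1 j e * (R.2.1 j e)⁻¹))), fun y => logVec (su2Quat (xt.2.2 y.1 * (R.2.2 y)⁻¹)))))) :
    ‖v‖ ^ 2 ≤ 200000 * (L : ℝ) ^ 4 * ρ := by
  have hsρ0 : 0 ≤ Real.sqrt ρ := Real.sqrt_nonneg ρ
  have hcoff : ∀ i, ‖(fixCoord v).2.1 i‖ ≤ Real.pi / 2 * (81 * Real.sqrt ρ) := fun i => by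
    rw [hv]; exact (norm_logVec_mul_inv_le _ _).trans (mul_le_mul_of_nonneg_left (hoff i) (by positivity))
  have hcslice : ∀ j e, ‖(fixCoord v).2.2.1 j e‖ ≤ Real.pi / 2 * (81 * Real.sqrt ρ) := fun j e => by
    rw [hv]; exact (norm_logVec_mul_inv_le _ _).trans (mul_le_mul_of_nonneg_left (hslice j e) (by positivity))
  have hcsite : ∀ y, ‖(fixCoord v).2.2.2 y‖ ≤ Real.pi / 2 * (81 * Real.sqrt ρ) := fun y => by
    rw [hv]; exact (norm_logVec_mul_inv_le _ _).trans (mul_le_mul_of_nonneg_left (hsite y) (by positivity))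
  have ht : t ^ 2 ≤ (Real.pi / 2) ^ 2 * ρ := by
    have h2 : |t| ≤ Real.pi / 2 * Real.sqrt ρ := (abs_le_pi_div_two_mul_abs_sin htπ).trans (mul_le_mul_of_nonneg_left hsin (by positivity))
    have h3 : |t| ^ 2 ≤ (Real.pi / 2 * Real.sqrt ρ) ^ 2 := pow_le_pow_left₀ (abs_nonneg t) h2 2
    rw [sq_abs, mul_pow, Real.sq_sqrt hρ0] at h3; exact h3
  have hfst : ‖(fixCoord v).1‖ ^ 2 = t ^ 2 + b₁ ^ 2 + b₂ ^ 2 := by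
    rw [hv, EuclideanSpace.norm_sq_eq, Fin.sum_univ_three]
    simp [Real.norm_eq_abs, sq_abs]
  have hπ4 : (Real.pi / 2) ^ 2 ≤ 5 / 2 := by nlinarith [Real.pi_lt_d2, Real.pi_pos]
  have hL1 : (1 : ℝ) ≤ L := by exact_mod_cast NeZero.one_le
  have hL0 : (0 : ℝ) ≤ L := by linarith
  have hcard1 : (Fintype.card {i : OffIdx L // ¬ i = e₀} : ℝ) ≤ 3 * (L : ℝ) ^ 3 := by
    have h1 := Fintype.card_subtype_le (fun i : OffIdx L => ¬ i = e₀)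
    have h2 := Fintype.card_subtype_le (fun e : Edge 3 L => ¬ treeEdge e = true)
    rw [FemtoTransferGap.card_edge_three] at h2
    exact_mod_cast h1.trans h2
  have hcard2 : (Fintype.card (Fin (2 * L - 1) × Edge 3 L) : ℝ) ≤ 6 * (L : ℝ) ^ 4 := by
    rw [Fintype.card_prod, Fintype.card_fin, FemtoTransferGap.card_edge_three]
    have : ((2 * L - 1 : ℕ) : ℝ) ≤ 2 * L := by
      have h := Nat.sub_le (2 * L) 1; exact_mod_cast h
    push_cast; nlinarith [pow_nonneg hL0 3]
  have hcard3 : (Fintype.card {y : Site 3 L // ¬ y = 0} : ℝ) ≤ (L : ℝ) ^ 3 := by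
    have h1 := Fintype.card_subtype_le (fun y : Site 3 L => ¬ y = 0)
    rw [FemtoTransferGap.TwoLattice.Electric.card_site] at h1
    exact_mod_cast h1
  have h1 : ∑ i, ‖(fixCoord v).2.1 i‖ ^ 2 ≤ (Fintype.card {i : OffIdx L // ¬ i = e₀} : ℝ) * (Real.pi / 2 * (81 * Real.sqrt ρ)) ^ 2 :=
    sum_sq_le_card_mul fun i => by rw [abs_of_nonneg (norm_nonneg _)]; exact hcoff i
  have h2 : ∑ je : Fin (2 * L - 1) × Edge 3 L, ‖(fixCoord v).2.2.1 je.1 je.2‖ ^ 2 ≤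
      (Fintype.card (Fin (2 * L - 1) × Edge 3 L) : ℝ) * (Real.pi / 2 * (81 * Real.sqrt ρ)) ^ 2 :=
    sum_sq_le_card_mul fun je => by rw [abs_of_nonneg (norm_nonneg _)]; exact hcslice je.1 je.2
  have h3 : ∑ y, ‖(fixCoord v).2.2.2 y‖ ^ 2 ≤ (Fintype.card {y : Site 3 L // ¬ y = 0} : ℝ) * (Real.pi / 2 * (81 * Real.sqrt ρ)) ^ 2 :=
    sum_sq_le_card_mul fun y => by rw [abs_of_nonneg (norm_nonneg _)]; exact hcsite y
  have e1 : (Real.pi / 2 * (81 * Real.sqrt ρ)) ^ 2 = (Real.pi / 2) ^ 2 * 6561 * ρ := by rw [mul_pow, mul_pow, Real.sq_sqrt hρ0]; ring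
  rw [e1] at h1 h2 h3
  have hL3 : (L : ℝ) ^ 3 ≤ (L : ℝ) ^ 4 := pow_le_pow_right₀ hL1 (by norm_num)
  have hMρ0 : 0 ≤ (Real.pi / 2) ^ 2 * 6561 * ρ := by positivity
  have hMρ_le : (Real.pi / 2) ^ 2 * 6561 * ρ ≤ 5 / 2 * 6561 * ρ := by nlinarith
  have hA1 := h1.trans (mul_le_mul_of_nonneg_right hcard1 hMρ0)
  have hA2 := h2.trans (mul_le_mul_of_nonneg_right hcard2 hMρ0)
  have hA3 := h3.trans (mul_le_mul_of_nonneg_right hcard3 hMρ0)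
  have hB : (L : ℝ) ^ 3 * ((Real.pi / 2) ^ 2 * 6561 * ρ) ≤ (L : ℝ) ^ 4 * ((Real.pi / 2) ^ 2 * 6561 * ρ) :=
    mul_le_mul_of_nonneg_right hL3 hMρ0
  have hC : (L : ℝ) ^ 4 * ((Real.pi / 2) ^ 2 * 6561 * ρ) ≤ (L : ℝ) ^ 4 * (5 / 2 * 6561 * ρ) :=
    mul_le_mul_of_nonneg_left hMρ_le (pow_nonneg hL0 4)
  have ht' : t ^ 2 ≤ 5 / 2 * ρ := ht.trans (mul_le_mul_of_nonneg_right hπ4 hρ0)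
  have hρL : ρ ≤ (L : ℝ) ^ 4 * ρ := by nlinarith [one_le_pow₀ (n := 4) hL1]
  rw [norm_sq_eq_blocks v, hfst]
  linarith [hA1, hA2, hA3, hB, hC, ht', hρL, hb]

/-- ★★ **Near a zero, the point lies in a tube of the anchor slice.**  In the setting of ✓`exists_conj_anchorSlice_of_ringDistSq_lt` (`L ≥ 2`, `z k₀ = true`,
reference data `(λ, N₀, C₀)` with `su2Quat C₀ = ιω_C`, `su2Quat N₀ = ιω_N`), with bases `Rb s` of the sign classes (`= Q_s` off the anchors): if `x′` is a
zero of `F_fix`, `D(ιx, ιx′) < ρ ≤ 1/1600` and `2·10⁵·L⁴·ρ ≤ R_V²`, then `x = k·fixSlice_s(fixCoord v)` for some `s`, `k ∈ SU(2)`, `‖v‖ ≤ R_V` — i.e. `x` lies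
in the tube `Θ_s(SU(2) × B̄(0,R_V))` of ✓`FixSplit.fix_hT`. [cite: Bredon1972, Ch. II §§4–5] -/
theorem exists_mem_fixTube_of_ringDistSq_lt (hL : 2 ≤ L) (z : Fin 3 → Bool) (hz : z ≠ fun _ => false) {k₀ : Fin 3} (hk₀ : z k₀ = true)
    {lam : Site 3 L → SU2} (hlamc : ∀ x, lam x ∈ Subgroup.center SU2) (hlam0 : lam 0 = 1)
    (hlamflip : ∀ (x : Site 3 L) (k : Fin 3), (x k = 0 ∨ x k = -1) → lam (x.shift k) = lam x * centreElem (z k))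
    (hlamstay : ∀ (x : Site 3 L) (k : Fin 3), x k ≠ 0 → x k ≠ -1 → lam (x.shift k) = lam x)
    {N₀ C₀ : SU2} (hN : (su2Quat N₀).re = 0) (hC : (su2Quat C₀).re = 0)
    (hNC : (su2Quat N₀).imI * (su2Quat C₀).imI + (su2Quat N₀).imJ * (su2Quat C₀).imJ + (su2Quat N₀).imK * (su2Quat C₀).imK = 0)
    {ωC ωN ωX : EuclideanSpace ℝ (Fin 3)} (hCω : ‖ωC‖ = 1) (hNω : ‖ωN‖ = 1) (hCN : ⟪ωC, ωN⟫ = 0) (hX : imQuat ωX = imQuat ωC * imQuat ωN)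
    (hC₀ : su2Quat C₀ = imQuat ωC) (hN₀ : su2Quat N₀ = imQuat ωN)
    (Rb : (Fin 3 → Bool) → FixRest L ⟨(((fun _ => (-1 : ZMod L)), k₀) : Edge 3 L), not_treeEdge_wrap hL k₀⟩ 0)
    (hRb1 : ∀ s i, (Rb s).1 i = combFlat (fun a => centreElem (s a) * (if z a then N₀ else 1)) i.1.1)
    (hRb2 : ∀ s j e, (Rb s).2.1 j e = combFlat (fun a => centreElem (s a) * (if z a then N₀ else 1)) e)
    (hRb3 : ∀ s x, (Rb s).2.2 x = lam x.1 * C₀)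
    (x x' : (OffIdx L → SU2) × ((Fin (2 * L - 1) → GaugeConfig 3 L SU2) × (Site 3 L → SU2)))
    (hx' : ringDeficit L z ((Fin.cons (glue x'.1) x'.2.1 : Fin (2 * L - 1 + 1) → GaugeConfig 3 L SU2), x'.2.2) = 0)
    {ρ RV : ℝ} (hρ : ρ ≤ 1 / 1600) (hRV0 : 0 ≤ RV) (hRV : 200000 * (L : ℝ) ^ 4 * ρ ≤ RV ^ 2)
    (hD : (∑ i : Fin (2 * L - 1 + 1), (6 * (L : ℝ) ^ 3 - timeCoupling su2Rep
        ((Fin.cons (glue x.1) x.2.1 : Fin (2 * L - 1 + 1) → GaugeConfig 3 L SU2) i)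
        ((Fin.cons (glue x'.1) x'.2.1 : Fin (2 * L - 1 + 1) → GaugeConfig 3 L SU2) i))) +
        ∑ y : Site 3 L, (2 - ((su2Rep (x.2.2 y * (x'.2.2 y)⁻¹)).trace).re) < ρ) :
    ∃ s : Fin 3 → Bool, x ∈ (fun q : SU2 × EuclideanSpace ℝ (Fin (fixDim L ⟨(((fun _ => (-1 : ZMod L)), k₀) : Edge 3 L), not_treeEdge_wrap hL k₀⟩ 0)) =>
      (((fun i => q.1 * (fixSlice ωC ωN ωX C₀ (centreElem (s k₀) * N₀) (Rb s) (fixCoord q.2)).1 i * q.1⁻¹),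
        ((fun j => gaugeTransform (fun _ : Site 3 L => q.1) ((fixSlice ωC ωN ωX C₀ (centreElem (s k₀) * N₀) (Rb s) (fixCoord q.2)).2.1 j)),
          (fun y => q.1 * (fixSlice ωC ωN ωX C₀ (centreElem (s k₀) * N₀) (Rb s) (fixCoord q.2)).2.2 y * q.1⁻¹))) :
        (OffIdx L → SU2) × ((Fin (2 * L - 1) → GaugeConfig 3 L SU2) × (Site 3 L → SU2)))) ''
      ((univ : Set SU2) ×ˢ closedBall (0 : EuclideanSpace ℝ (Fin (fixDim L ⟨(((fun _ => (-1 : ZMod L)), k₀) : Edge 3 L), not_treeEdge_wrap hL k₀⟩ 0))) RV) := by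
  obtain ⟨s, k, t, b₁, b₂, htπ, hsin, hb, hseam, hlink, hoff, hslice, hsite⟩ :=
    exists_conj_anchorSlice_of_ringDistSq_lt hL z hz hk₀ hlamc hlam0 hlamflip hlamstay hN hC hNC hCω hNω hCN hX hC₀ hN₀ x x' hx' hρ hD
  -- the translated point `k·x`
  obtain ⟨xt, hxt⟩ : ∃ xt : (OffIdx L → SU2) × ((Fin (2 * L - 1) → GaugeConfig 3 L SU2) × (Site 3 L → SU2)),
      xt = ((fun i => k * x.1 i * k⁻¹), ((fun j => gaugeTransform (fun _ : Site 3 L => k) (x.2.1 j)), (fun y => k * x.2.2 y * k⁻¹))) := ⟨_, rfl⟩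
  have hxt1 : ∀ i, xt.1 i = k * x.1 i * k⁻¹ := fun i => by rw [hxt]
  have hxt2 : ∀ j e, xt.2.1 j e = k * x.2.1 j e * k⁻¹ := fun j e => by rw [hxt]; rfl
  have hxt3 : ∀ y, xt.2.2 y = k * x.2.2 y * k⁻¹ := fun y => by rw [hxt]
  have hρ0 : 0 ≤ ρ := by
    have h0 := norm_sq_site_le_ringDistSq x x' 0
    nlinarith [sq_nonneg ‖su2Quat (x.2.2 0) - su2Quat (x'.2.2 0)‖]
  have hsρ0 : 0 ≤ Real.sqrt ρ := Real.sqrt_nonneg ρ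
  -- the slice coordinates of `k·x`
  obtain ⟨yc, hyc⟩ : ∃ yc : EuclideanSpace ℝ (Fin 3) × RestParam L ⟨(((fun _ => (-1 : ZMod L)), k₀) : Edge 3 L), not_treeEdge_wrap hL k₀⟩ 0,
      yc = (toLp 2 ![t, b₁, b₂],
        ((fun i => logVec (su2Quat (xt.1 i.1 * ((Rb s).1 i)⁻¹))),
          ((fun j e => logVec (su2Quat (xt.2.1 j e * ((Rb s).2.1 j e)⁻¹))), fun y => logVec (su2Quat (xt.2.2 y.1 * ((Rb s).2.2 y)⁻¹))))) :=
    ⟨_, rfl⟩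
  have hσ : fixSlice ωC ωN ωX C₀ (centreElem (s k₀) * N₀) (Rb s) yc = xt := by
    rw [hyc]; exact fixSlice_logCoords_eq ωC ωN ωX C₀ _ (Rb s) xt (by rw [hxt3]; exact hseam) (by rw [hxt1]; exact hlink)
  obtain ⟨v, hv⟩ := exists_fixCoord_eq yc
  -- the size of the coordinates
  have hvn : ‖v‖ ^ 2 ≤ 200000 * (L : ℝ) ^ 4 * ρ := by
    refine norm_sq_le_of_logCoords (Rb s) xt hρ0 htπ hsin hb (fun i => ?_) (fun j e => ?_) (fun y => ?_) v (by rw [hv, hyc])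
    · rw [hRb1, hxt1]; exact hoff i.1
    · rw [hRb2, hxt2]; exact hslice j e
    · rw [hRb3, hxt3]; exact hsite y.1
  have hvR : ‖v‖ ≤ RV := by
    refine (pow_le_pow_iff_left₀ (norm_nonneg v) hRV0 two_ne_zero).mp ?_
    exact hvn.trans hRV
  -- `x = k⁻¹ · (k·x)`
  refine ⟨s, ⟨(k⁻¹, v), ⟨mem_univ _, mem_closedBall_zero_iff.mpr hvR⟩, ?_⟩⟩
  dsimp only
  rw [hv, hσ, hxt]
  refine Prod.ext ?_ (Prod.ext ?_ ?_)
  · funext i; dsimp only; rw [inv_inv]; group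
  · funext j e
    show k⁻¹ * (k * x.2.1 j e * k⁻¹) * k⁻¹⁻¹ = x.2.1 j e
    rw [inv_inv]; group
  · funext y; dsimp only; rw [inv_inv]; group

/-! ## §4 The floor off the tubes -/

/-- The base ring in `X_fix` letters is a zero of `F_fix` (so the zero set is non-empty). [cite: Luscher1983, §2] -/
theorem ringDeficit_fix_reference_eq_zero (hL : 2 ≤ L) (z : Fin 3 → Bool)
    {lam : Site 3 L → SU2} (hlamc : ∀ x, lam x ∈ Subgroup.center SU2)
    (hlamflip : ∀ (x : Site 3 L) (k : Fin 3), (x k = 0 ∨ x k = -1) → lam (x.shift k) = lam x * centreElem (z k))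
    (hlamstay : ∀ (x : Site 3 L) (k : Fin 3), x k ≠ 0 → x k ≠ -1 → lam (x.shift k) = lam x)
    {N₀ C₀ : SU2} (hN : (su2Quat N₀).re = 0) (hC : (su2Quat C₀).re = 0)
    (hNC : (su2Quat N₀).imI * (su2Quat C₀).imI + (su2Quat N₀).imJ * (su2Quat C₀).imJ + (su2Quat N₀).imK * (su2Quat C₀).imK = 0)
    (s : Fin 3 → Bool) :
    ringDeficit L z ((Fin.cons (glue (fun i : OffIdx L => combFlat (fun a => centreElem (s a) * (if z a then N₀ else 1)) i.1))
        (fun _ : Fin (2 * L - 1) => combFlat (fun a => centreElem (s a) * (if z a then N₀ else 1))) : Fin (2 * L - 1 + 1) → GaugeConfig 3 L SU2),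
      fun x : Site 3 L => lam x * C₀) = 0 := by
  have hglue : glue (fun i : OffIdx L => combFlat (fun a => centreElem (s a) * (if z a then N₀ else 1)) i.1) =
      combFlat (fun a => centreElem (s a) * (if z a then N₀ else 1)) := by
    funext e
    by_cases he : treeEdge e = true
    · rw [glue_apply_of_tree _ he, combFlat_apply_of_tree _ he]
    · rw [glue_apply_of_not_tree _ he]
  have hcons : (Fin.cons (glue (fun i : OffIdx L => combFlat (fun a => centreElem (s a) * (if z a then N₀ else 1)) i.1))
        (fun _ : Fin (2 * L - 1) => combFlat (fun a => centreElem (s a) * (if z a then N₀ else 1))) : Fin (2 * L - 1 + 1) → GaugeConfig 3 L SU2) =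
      fun _ => combFlat (fun a => centreElem (s a) * (if z a then N₀ else 1)) := by
    rw [hglue]; funext i; exact Fin.cases rfl (fun _ => rfl) i
  rw [hcons]
  exact ringDeficit_reference_eq_zero hL z hlamc hlamflip hlamstay hN hC hNC s

/-- ★★ **The floor off the tubes (`hfloor` of ✓`sharpTwistedLaplace_of_fixTubes`).**  With the constants `K, q, L₀` of ✓`QuantitativeLaplace.ringDeficit_fix_floor`:
for `L ≥ max(L₀, 2)`, `z ≠ 0`, reference data as in ✓`exists_mem_fixTube_of_ringDistSq_lt`, and radii `0 < ρ ≤ 1/1600`, `2·10⁵·L⁴·ρ ≤ R_V²`, every `x ∈ X_fix`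
outside ALL the tubes `Θ_s(SU(2) × B̄(0,R_V))` has `F_fix(x) ≥ min((K·L^q)⁻¹, ρ/(1010·L⁶·K·L^q))`. [cite: Bredon1972, Ch. II §§4–5] [cite: Luscher1983, §2] -/
theorem ringDeficit_fix_floor_off_tubes :
    ∃ K : ℝ, 0 < K ∧ ∃ q : ℝ, 0 ≤ q ∧ ∃ L₀ : ℕ, ∀ (L : ℕ) [NeZero L] (hL₀ : L₀ ≤ L) (hL : 2 ≤ L) (z : Fin 3 → Bool) (hz : z ≠ fun _ => false)
      {k₀ : Fin 3} (hk₀ : z k₀ = true)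
      {lam : Site 3 L → SU2} (hlamc : ∀ x, lam x ∈ Subgroup.center SU2) (hlam0 : lam 0 = 1)
      (hlamflip : ∀ (x : Site 3 L) (k : Fin 3), (x k = 0 ∨ x k = -1) → lam (x.shift k) = lam x * centreElem (z k))
      (hlamstay : ∀ (x : Site 3 L) (k : Fin 3), x k ≠ 0 → x k ≠ -1 → lam (x.shift k) = lam x)
      {N₀ C₀ : SU2} (hN : (su2Quat N₀).re = 0) (hC : (su2Quat C₀).re = 0)
      (hNC : (su2Quat N₀).imI * (su2Quat C₀).imI + (su2Quat N₀).imJ * (su2Quat C₀).imJ + (su2Quat N₀).imK * (su2Quat C₀).imK = 0)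
      {ωC ωN ωX : EuclideanSpace ℝ (Fin 3)} (hCω : ‖ωC‖ = 1) (hNω : ‖ωN‖ = 1) (hCN : ⟪ωC, ωN⟫ = 0) (hX : imQuat ωX = imQuat ωC * imQuat ωN)
      (hC₀ : su2Quat C₀ = imQuat ωC) (hN₀ : su2Quat N₀ = imQuat ωN)
      (Rb : (Fin 3 → Bool) → FixRest L ⟨(((fun _ => (-1 : ZMod L)), k₀) : Edge 3 L), not_treeEdge_wrap hL k₀⟩ 0)
      (hRb1 : ∀ s i, (Rb s).1 i = combFlat (fun a => centreElem (s a) * (if z a then N₀ else 1)) i.1.1)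
      (hRb2 : ∀ s j e, (Rb s).2.1 j e = combFlat (fun a => centreElem (s a) * (if z a then N₀ else 1)) e)
      (hRb3 : ∀ s x, (Rb s).2.2 x = lam x.1 * C₀)
      {ρ RV : ℝ} (hρ0 : 0 < ρ) (hρ : ρ ≤ 1 / 1600) (hRV0 : 0 ≤ RV) (hRV : 200000 * (L : ℝ) ^ 4 * ρ ≤ RV ^ 2)
      (x : (OffIdx L → SU2) × ((Fin (2 * L - 1) → GaugeConfig 3 L SU2) × (Site 3 L → SU2))),
      (∀ s : Fin 3 → Bool, x ∉ (fun q : SU2 × EuclideanSpace ℝ (Fin (fixDim L ⟨(((fun _ => (-1 : ZMod L)), k₀) : Edge 3 L), not_treeEdge_wrap hL k₀⟩ 0)) =>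
        (((fun i => q.1 * (fixSlice ωC ωN ωX C₀ (centreElem (s k₀) * N₀) (Rb s) (fixCoord q.2)).1 i * q.1⁻¹),
          ((fun j => gaugeTransform (fun _ : Site 3 L => q.1) ((fixSlice ωC ωN ωX C₀ (centreElem (s k₀) * N₀) (Rb s) (fixCoord q.2)).2.1 j)),
            (fun y => q.1 * (fixSlice ωC ωN ωX C₀ (centreElem (s k₀) * N₀) (Rb s) (fixCoord q.2)).2.2 y * q.1⁻¹))) :
          (OffIdx L → SU2) × ((Fin (2 * L - 1) → GaugeConfig 3 L SU2) × (Site 3 L → SU2)))) ''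
        ((univ : Set SU2) ×ˢ closedBall (0 : EuclideanSpace ℝ (Fin (fixDim L ⟨(((fun _ => (-1 : ZMod L)), k₀) : Edge 3 L), not_treeEdge_wrap hL k₀⟩ 0))) RV)) →
      min (K * (L : ℝ) ^ q)⁻¹ (ρ / (1010 * (L : ℝ) ^ 6 * (K * (L : ℝ) ^ q))) ≤
        ringDeficit L z ((Fin.cons (glue x.1) x.2.1 : Fin (2 * L - 1 + 1) → GaugeConfig 3 L SU2), x.2.2) := by
  obtain ⟨K, hK, q, hq, L₀, hfloor⟩ := QuantitativeLaplace.ringDeficit_fix_floor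
  refine ⟨K, hK, q, hq, L₀, ?_⟩
  intro L _ hL₀ hL z hz k₀ hk₀ lam hlamc hlam0 hlamflip hlamstay N₀ C₀ hN hC hNC ωC ωN ωX hCω hNω hCN hX hC₀ hN₀ Rb hRb1 hRb2 hRb3 ρ RV hρ0 hρ hRV0
    hRV x hout
  refine hfloor L hL₀ z hz ρ hρ0 x (le_csInf ?_ ?_)
  · -- the zero set is non-empty
    refine ⟨_, ⟨((fun i : OffIdx L => combFlat (fun a => centreElem (false) * (if z a then N₀ else 1)) i.1),
      ((fun _ : Fin (2 * L - 1) => combFlat (fun a => centreElem (false) * (if z a then N₀ else 1))), fun y : Site 3 L => lam y * C₀)), ?_, rfl⟩⟩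
    exact ringDeficit_fix_reference_eq_zero hL z hlamc hlamflip hlamstay hN hC hNC (fun _ => false)
  · rintro d ⟨x', hx', rfl⟩
    by_contra hlt
    push Not at hlt
    obtain ⟨s, hs⟩ := exists_mem_fixTube_of_ringDistSq_lt hL z hz hk₀ hlamc hlam0 hlamflip hlamstay hN hC hNC hCω hNω hCN hX hC₀ hN₀ Rb hRb1 hRb2 hRb3
      x x' hx' hρ hRV0 hRV hlt
    exact hout s hs

end Summit.QuantumFields.YangMills.Theorems.VirialFluxGap.AnchorSlice
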